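import Summits.QuantumFields.BalabanUV.Beta.CombHId1Sandwich

/-!
# `BalabanUV.Beta.CombHId2Letters` — binder row D1 (OWNER an2), (J-a) dictionary, item (C2) of TID § F.10 (L2′) at ORDER 2, part ONE: **PERIODISATION
# COMMUTES WITH THE MULTIPLIER-COLUMN VERTEX `vertexOfM`, WITH `dM`, AND WITH THE INVERSE's BACKGROUND DERIVATIVE `K2OfK`** — the order-2 lattice words of
# `SecondOrderResponse` (the ingredients of `K3OfK` ∕ `e4OfKW`, hence of `T2RecOf (j+1)`) periodised on a box, by REDUCTION to C2a's `dper_vertexOfK`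
# through the coarse-sublattice MASK (no new summability argument)

WHY.  The door's `hId₂` row (leaf-05 g29 `CoarseJetOrderTwoGradedComb.torus_hId₂_iff_graded_comb`) is a polynomial in the torus blocks of the level-`j` first and
second jets; the lattice side is `T2RecOf … (j+1) = (cE₂·wV4 (j+1)) • e4OfKW Lc (GcombSh Lc j) S_j M_j W_j + (cB·wB2 (j+1)) • vh₂S` with
`e4OfKW = mmRead ∘ K3OfK`, `K3OfK = −K·dM_b·K2_{b′} − K·dM_{b′}·K2_b − K·W_{bb′}·K`, `K2_b = −K·dM_b·K`, `dM = vertexOfK + vertexOfM`.  C2a∕C2b periodised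
`vertexOfK`, sandwiches and `e3OfK`; this file adds the MULTIPLIER-column vertex and the words built from `dM`.  The trick: `vertexOfM K N Mt` IS an4's
`vertexOfK` for the MASKED kernel `K^♭` (multiplier rows of `K` moved to field slots, supported on the coarse sublattice) and the MASKED family
`Mt^♭ ρ u := onLat N (Mt ρ) u` — so C2a's theorem applies verbatim.

WHAT ([folklore]; 0 `def` — the masks are written as lambda terms —, 0 cited fact, 0 `def … : Prop`, 0 sorry).
* §1 the masks and their letters: invariance ∕ decay of `K^♭`, period covariance ∕ localisation of `Mt^♭`, `vertexOfM_eq_vertexOfK_mask`, `dper_onLat`.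
* §2 **`dper_vertexOfM`**: `dper M (vertexOfM K N Mt μ y) = vertexOfM K N (fun ρ w => dper M (Mt ρ w)) μ y` (M = N·M′; `K` invariant + decaying; `Mt` a
  coarse-bond-localised, `M′`-period-covariant table).
* §3 **`dper_dM`**, **`dper_K2OfK`** (C2b `dper_sandwich` + §2 + C2a).
WHAT THIS IS NOT: not `K3OfK`∕`e4OfKW` (two-insertion words need the second slot's copy sum — part TWO), not the door's `hId₂`; nothing of Bałaban's asserted;
`D1Tel` ∕ `D1Rep` OPEN; NOT (T-ID), NOT D1, NEVER «G-an2-4 closed», NOT BetaPertH, NOT continuum, NOT Clay.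

HONEST DEPENDENCY (page 1, mandatory): continuum YM on T⁴ ⇐ BetaPertH ∧ nine spine estimates (0/9 proved); BetaPertH ⇐ (D1) ∧ (D4) ∧ CAP+tail;
G-an2-4 gates asym, D1 and NE2/3/4.  HONEST FRAMING (cell contract, verbatim): «discharging `BetaPertH` makes Bałaban's UV stability UNCONDITIONAL —
a real constructive-QFT result; it is NOT the continuum limit and NOT the Clay problem.»  ABSOLUTE RULE (cell charter, verbatim): «No internally-minted
statement may enter as a cited fact. Every hypothesis is either kernel-proved in this package or a verbatim quotation of a PUBLISHED theorem with page
reference. The manuscript(s) under audit are NOT citable for their own disputed steps — they are the thing under adjudication; programme-internal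
(2001/route/tribunal) claims are never citable.»  Row D1 OWNER an2 (b2b-balaban-beta-an2) gen 43, 2026-08-22; over C2a∕C2b BY NAME.  No existing file touched.
-/

noncomputable section

open scoped BigOperators

namespace Summit.QuantumFields.BalabanUV.Beta.CombHId2Letters

open Finset
open Literature.Probability.LatticeModels (Torus.proj)
open Literature.MathematicalPhysics.QuantumFieldTheory.Balaban1983to89
open Literature.MathematicalPhysics.QuantumFieldTheory.Balaban1983to89.Beta
open B4TorusKernel.MultiPeriod (translate translate_apply)
open B6Lemma24Torus (pbox)
open ExpKernelCalculus (MKer Decays BiLoc VertexFamily comp)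
open AffineAveraging (Site)
open Literature.MathematicalPhysics.QuantumFieldTheory.LatticeForm (quo)
open OneStepResolventKernel (Fib proj_zsmul quo_zsmul eq_zsmul_quo_of_proj)
open OneStepKernelFamily (vertexOfK)
open InterLevelTransport (onLat onLat_zsmul onLat_off cwsum cwsum_apply)
open SecondOrderResponse (colM vertexOfM dM K2OfK)
open Summit.QuantumFields.BalabanUV.Beta.FP.KernelPeriodisationFibLoc (dper dper_apply)
open Summit.QuantumFields.BalabanUV.Beta.CombHId1Letters (vertexOfK_apply dper_vertexOfK)

variable {d : ℕ} (M : Fin (d + 1) → ℕ) [∀ μ, NeZero (M μ)] {N : ℕ} [NeZero N]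

/-! ## §1 The coarse-sublattice masks -/

section Mask

variable (K : MKer (d + 1) (Fib d)) (Mt : Fin (d + 1) → Site (d + 1) → MKer (d + 1) (Fib d))

omit [∀ μ, NeZero (M μ)] in
/-- [folklore] **THE MULTIPLIER-COLUMN VERTEX IS an4's VERTEX FOR THE MASKED PAIR**: with `K^♭ u v (inl ρ) b := [u ∈ Nℤ^{d+1}]·K u v (inr ρ) b`
(and `0` on `inr`-rows) and `Mt^♭ ρ u := onLat N (Mt ρ) u`, `vertexOfM K N Mt μ y = vertexOfK K^♭ N Mt^♭ μ y`. -/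
theorem vertexOfM_eq_vertexOfK_mask (μ : Fin (d + 1)) (y : Site (d + 1)) :
    vertexOfM K N Mt μ y
      = vertexOfK (fun u v a b => match a with
          | Sum.inl ρ => if Torus.proj N u = 0 then K u v (Sum.inr ρ) b else 0
          | Sum.inr _ => 0) N (fun ρ u => onLat N (Mt ρ) u) μ y := by
  funext x z a b
  rw [vertexOfK_apply]
  unfold vertexOfM
  refine Finset.sum_congr rfl fun ρ _ => ?_
  show cwsum N (colM K N μ y ρ) (Mt ρ) x z a b
    = ∑' u : Site (d + 1), (if Torus.proj N u = 0 then K u ((N : ℤ) • y) (Sum.inr ρ) (Sum.inr μ) else 0) * onLat N (Mt ρ) u x z a b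
  rw [cwsum_apply]
  have hinj : Function.Injective (fun w : Site (d + 1) => (N : ℤ) • w) := fun w w' h => by
    simpa only [quo_zsmul] using congrArg (quo N) h
  rw [← hinj.tsum_eq (f := fun u => (if Torus.proj N u = 0 then K u ((N : ℤ) • y) (Sum.inr ρ) (Sum.inr μ) else 0) * onLat N (Mt ρ) u x z a b)]
  · refine tsum_congr fun w => ?_
    simp only [proj_zsmul, if_true, onLat_zsmul, colM]
  · intro u hu
    by_cases h0 : Torus.proj N u = 0
    · exact ⟨quo N u, (eq_zsmul_quo_of_proj (N := N) h0).symm⟩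
    · exact (hu (by simp only [h0, if_false, zero_mul])).elim

omit [∀ μ, NeZero (M μ)] [NeZero N] in
/-- [folklore] the masked kernel is invariant under the period lattice when `K` is and `N ∣ M i` (the mask `[u ∈ Nℤ]` is `Mℤ`-periodic). -/
theorem mask_translate_inv (hM : ∀ i, N ∣ M i)
    (hKinv : ∀ (m x z : Site (d + 1)) (a b : Fib d), K (translate M x m) (translate M z m) a b = K x z a b)
    (m u v : Site (d + 1)) (a b : Fib d) :
    (fun u v (a b : Fib d) => match a with
        | Sum.inl ρ => if Torus.proj N u = 0 then K u v (Sum.inr ρ) b else 0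
        | Sum.inr _ => (0 : ℝ)) (translate M u m) (translate M v m) a b
      = (fun u v (a b : Fib d) => match a with
        | Sum.inl ρ => if Torus.proj N u = 0 then K u v (Sum.inr ρ) b else 0
        | Sum.inr _ => (0 : ℝ)) u v a b := by
  have hproj : Torus.proj N (translate M u m) = Torus.proj N u := by
    choose c hc using hM
    funext i
    simp only [Literature.Probability.LatticeModels.Torus.proj_apply, translate_apply, hc i, Nat.cast_mul, Int.cast_add, Int.cast_mul,
      Int.cast_natCast, ZMod.natCast_self, zero_mul, add_zero]
  rcases a with ρ | ρ
  · simp only [hproj, hKinv]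
  · rfl

omit [∀ μ, NeZero (M μ)] [NeZero N] in
/-- [folklore] the masked kernel decays like `K` (same constant `C ≥ 0`, same rate). -/
theorem decays_mask {C δ : ℝ} (hK : Decays K C δ) (hC : 0 ≤ C) :
    Decays (fun u v (a b : Fib d) => match a with
        | Sum.inl ρ => if Torus.proj N u = 0 then K u v (Sum.inr ρ) b else 0
        | Sum.inr _ => (0 : ℝ)) C δ := by
  intro u v a b
  rcases a with ρ | ρ
  · by_cases h : Torus.proj N u = 0
    · simp only [h, if_true]; exact hK u v _ b
    · simp only [h, if_false, abs_zero]; positivity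
  · simp only [abs_zero]; positivity

omit [∀ μ, NeZero (M μ)] in
/-- [folklore] the masked table is period covariant on the FINE lattice when the coarse table is `M′`-period covariant (`M = N·M′`). -/
theorem onLat_periodCov {M' : Fin (d + 1) → ℕ} (hM : ∀ i, M i = N * M' i)
    (hMt : ∀ (ρ : Fin (d + 1)) (w m x z : Site (d + 1)) (a b : Fib d),
      Mt ρ (translate M' w m) (translate M x m) (translate M z m) a b = Mt ρ w x z a b)
    (ρ : Fin (d + 1)) (u m x z : Site (d + 1)) (a b : Fib d) :
    onLat N (Mt ρ) (translate M u m) (translate M x m) (translate M z m) a b = onLat N (Mt ρ) u x z a b := by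
  have htr : translate M u m = u + (N : ℤ) • translate M' 0 m := by
    funext i; simp only [translate_apply, Pi.add_apply, Pi.smul_apply, Pi.zero_apply, smul_eq_mul, hM i, Nat.cast_mul, zero_add]; ring
  by_cases h : Torus.proj N u = 0
  · obtain ⟨w, rfl⟩ : ∃ w, u = (N : ℤ) • w := ⟨quo N u, eq_zsmul_quo_of_proj (N := N) h⟩
    have e : translate M ((N : ℤ) • w) m = (N : ℤ) • translate M' w m := by
      funext i; simp only [translate_apply, Pi.smul_apply, smul_eq_mul, hM i, Nat.cast_mul]; ring
    rw [e]
    show onLat N (Mt ρ) ((N : ℤ) • translate M' w m) (translate M x m) (translate M z m) a b = onLat N (Mt ρ) ((N : ℤ) • w) x z a b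
    rw [onLat_zsmul, onLat_zsmul, hMt]
  · have h' : Torus.proj N (translate M u m) ≠ 0 := by
      rwa [htr, Literature.MathematicalPhysics.QuantumFieldTheory.LatticeForm.proj_add_zsmul]
    show onLat N (Mt ρ) (translate M u m) (translate M x m) (translate M z m) a b = onLat N (Mt ρ) u x z a b
    rw [onLat_off (Mt ρ) h', onLat_off (Mt ρ) h]
    rfl

omit [∀ μ, NeZero (M μ)] in
/-- [folklore] the masked table is bond-localised at its FINE index (`VertexFamily Mt N CM δ` ⇒ `BiLoc (Mt^♭ ρ u) u u CM δ`; off the sublattice it is `0`). -/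
theorem biLoc_onLat {CM δ : ℝ} (hMt : VertexFamily Mt N CM δ) (ρ : Fin (d + 1)) (u : Site (d + 1)) :
    BiLoc (onLat N (Mt ρ) u) u u CM δ := by
  intro x z a b
  by_cases h : Torus.proj N u = 0
  · obtain ⟨w, rfl⟩ : ∃ w, u = (N : ℤ) • w := ⟨quo N u, eq_zsmul_quo_of_proj (N := N) h⟩
    rw [show onLat N (Mt ρ) ((N : ℤ) • w) x z a b = Mt ρ w x z a b by rw [onLat_zsmul]]
    exact hMt ρ w x z a b
  · rw [show onLat N (Mt ρ) u x z a b = 0 by rw [onLat_off (Mt ρ) h]; rfl, abs_zero]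
    exact mul_nonneg ((hMt 0 0).nonneg (Sum.inl 0)) (Real.exp_pos _).le

omit [∀ μ, NeZero (M μ)] in
/-- [folklore] `dper` of the masked table is the mask of the `dper`s. -/
theorem dper_onLat (ρ : Fin (d + 1)) (u : Site (d + 1)) :
    dper M (onLat N (Mt ρ) u) = onLat N (fun w => dper M (Mt ρ w)) u := by
  by_cases h : Torus.proj N u = 0
  · obtain ⟨w, rfl⟩ : ∃ w, u = (N : ℤ) • w := ⟨quo N u, eq_zsmul_quo_of_proj (N := N) h⟩
    rw [onLat_zsmul, onLat_zsmul]
  · rw [onLat_off (Mt ρ) h, onLat_off _ h]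
    funext x z a b
    simp only [dper_apply]
    exact tsum_zero

/-! ## §2 Periodisation commutes with the multiplier-column vertex -/

/-- [folklore] **`dper_vertexOfM` — PERIODISATION COMMUTES WITH THE MULTIPLIER-COLUMN VERTEX**: for `M = N·M′`, `K` invariant under the period lattice and
decaying, and a coarse-bond table `Mt` that is `M′`-period covariant (`hMt`) and localised at its coarse bond (`VertexFamily Mt N CM δM`):
`dper M (vertexOfM K N Mt μ y) = vertexOfM K N (fun ρ w => dper M (Mt ρ w)) μ y` — C2a's `dper_vertexOfK` for the masked pair, un-masked by `dper_onLat`. -/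
theorem dper_vertexOfM {M' : Fin (d + 1) → ℕ} (hM : ∀ i, M i = N * M' i)
    (hKinv : ∀ (m x z : Site (d + 1)) (a b : Fib d), K (translate M x m) (translate M z m) a b = K x z a b)
    {CK δK CM δM : ℝ} (hK : Decays K CK δK) (hCK : 0 ≤ CK) (hδK : 0 < δK)
    (hMt : ∀ (ρ : Fin (d + 1)) (w m x z : Site (d + 1)) (a b : Fib d),
      Mt ρ (translate M' w m) (translate M x m) (translate M z m) a b = Mt ρ w x z a b)
    (hMloc : VertexFamily Mt N CM δM) (hδM : 0 < δM) (μ : Fin (d + 1)) (y : Site (d + 1)) :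
    dper M (vertexOfM K N Mt μ y) = vertexOfM K N (fun ρ w => dper M (Mt ρ w)) μ y := by
  have hLM : ∀ i, N ∣ M i := fun i => ⟨M' i, hM i⟩
  rw [vertexOfM_eq_vertexOfK_mask K Mt, vertexOfM_eq_vertexOfK_mask K (fun ρ w => dper M (Mt ρ w)),
    dper_vertexOfK M (mask_translate_inv M K hLM hKinv) (decays_mask K hK hCK) hCK hδK (onLat_periodCov M Mt hM hMt) (biLoc_onLat Mt hMloc)
      ((hMloc 0 0).nonneg (Sum.inl 0)) hδM μ y]
  congr 1
  funext ρ u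
  exact dper_onLat M Mt ρ u

end Mask

/-! ## §3 Periodisation commutes with `dM` and with `K2OfK` -/

section DM

variable (K : MKer (d + 1) (Fib d)) (S Mt : Fin (d + 1) → Site (d + 1) → MKer (d + 1) (Fib d))

omit [∀ μ, NeZero (M μ)] [NeZero N] in
/-- [folklore] `dper` of a sum of two bi-localised kernels is the sum of the `dper`s (both period sums converge, `summable_dper`). -/
theorem dper_add_of_biLoc [∀ μ, NeZero (M μ)] {A B : MKer (d + 1) (Fib d)} {p q : Site (d + 1)} {CA δA CB δB : ℝ}
    (hA : BiLoc A p p CA δA) (hδA : 0 < δA) (hB : BiLoc B q q CB δB) (hδB : 0 < δB) :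
    dper M (A + B) = dper M A + dper M B := by
  funext x y e f
  simp only [dper_apply, Pi.add_apply]
  exact (FP.KernelPeriodisationFibLoc.summable_dper M hA (hA.nonneg (Sum.inl 0)) hδA x y e f).tsum_add
    (FP.KernelPeriodisationFibLoc.summable_dper M hB (hB.nonneg (Sum.inl 0)) hδB x y e f)

/-- [folklore] **`dper_dM` — PERIODISATION COMMUTES WITH THE BACKGROUND DERIVATIVE OF THE OPERATOR** `dM = vertexOfK + vertexOfM`
(C2a `dper_vertexOfK` + §2 `dper_vertexOfM`; the two summands are bi-localised at `N•y`, so `dper` is additive on them). -/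
theorem dper_dM {M' : Fin (d + 1) → ℕ} (hM : ∀ i, M i = N * M' i)
    (hKinv : ∀ (m x z : Site (d + 1)) (a b : Fib d), K (translate M x m) (translate M z m) a b = K x z a b)
    {CK δK CS δS CM δM : ℝ} (hK : Decays K CK δK) (hCK : 0 ≤ CK) (hδK : 0 < δK)
    (hSt : ∀ (κ : Fin (d + 1)) (u m x z : Site (d + 1)) (a b : Fib d), S κ (translate M u m) (translate M x m) (translate M z m) a b = S κ u x z a b)
    (hS : ∀ κ u, BiLoc (S κ u) u u CS δS) (hδS : 0 < δS)
    (hMt : ∀ (ρ : Fin (d + 1)) (w m x z : Site (d + 1)) (a b : Fib d),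
      Mt ρ (translate M' w m) (translate M x m) (translate M z m) a b = Mt ρ w x z a b)
    (hMloc : VertexFamily Mt N CM δM) (hδM : 0 < δM) (μ : Fin (d + 1)) (y : Site (d + 1)) :
    dper M (dM K N S Mt μ y) = dM K N (fun κ u => dper M (S κ u)) (fun ρ w => dper M (Mt ρ w)) μ y := by
  have hCS : 0 ≤ CS := (hS 0 0).nonneg (Sum.inl 0)
  have hCM : 0 ≤ CM := (hMloc 0 0).nonneg (Sum.inl 0)
  -- the two summands are bi-localised at `N•y`
  have h1 := CombHId1Sandwich.biLoc_vertexOfK (N := N) hK hδK hS hδS μ y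
  have hδ₀ : 0 < min δK δM := lt_min hδK hδM
  have h2 := SecondOrderResponse.vertexFamily_vertexOfM (N := N) hK hCK (BalabanStepW2.vertexFamily_mono' hMloc hCM (min_le_right δK δM)) hδ₀
    (min_le_left δK δM) μ y
  unfold dM
  rw [dper_add_of_biLoc M h1 (half_pos (lt_min hδK hδS)) h2 (half_pos hδ₀), dper_vertexOfK M hKinv hK hCK hδK hSt hS hCS hδS μ y,
    dper_vertexOfM M K Mt hM hKinv hK hCK hδK hMt hMloc hδM μ y]

/-- [folklore] **`dper_K2OfK` — PERIODISATION COMMUTES WITH THE BACKGROUND DERIVATIVE OF THE INVERSE** `K2OfK K N S Mt b = −K ∘ dM_b ∘ K`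
(C2b `dper_sandwich` on the bi-localised `dM_b` — `SecondOrderResponse.vertexFamily_dM` — then `dper_dM`). -/
theorem dper_K2OfK {M' : Fin (d + 1) → ℕ} (hM : ∀ i, M i = N * M' i)
    (hKinv : ∀ (m x z : Site (d + 1)) (a b : Fib d), K (translate M x m) (translate M z m) a b = K x z a b)
    {CK δK CS δS CM δM : ℝ} (hK : Decays K CK δK) (hCK : 0 ≤ CK) (hδK : 0 < δK)
    (hSt : ∀ (κ : Fin (d + 1)) (u m x z : Site (d + 1)) (a b : Fib d), S κ (translate M u m) (translate M x m) (translate M z m) a b = S κ u x z a b)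
    (hS : ∀ κ u, BiLoc (S κ u) u u CS δS) (hδS : 0 < δS)
    (hMt : ∀ (ρ : Fin (d + 1)) (w m x z : Site (d + 1)) (a b : Fib d),
      Mt ρ (translate M' w m) (translate M x m) (translate M z m) a b = Mt ρ w x z a b)
    (hMloc : VertexFamily Mt N CM δM) (hδM : 0 < δM) (ν : Fin (d + 1)) (y' : Site (d + 1)) :
    dper M (K2OfK K N S Mt ν y') = K2OfK K N (fun κ u => dper M (S κ u)) (fun ρ w => dper M (Mt ρ w)) ν y' := by
  have hCS : 0 ≤ CS := (hS 0 0).nonneg (Sum.inl 0)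
  have hCM : 0 ≤ CM := (hMloc 0 0).nonneg (Sum.inl 0)
  -- `dM_b` is bi-localised at `N•y'` at the common rate
  set r : ℝ := min δK (min δS δM) with hr
  have hr0 : 0 < r := lt_min hδK (lt_min hδS hδM)
  have hSr : OneStepResolventKernel.LocStencil S CS r := fun κ u =>
    OneStepResolventKernel.biLoc_mono (hS κ u) hCS ((min_le_right _ _).trans (min_le_left _ _))
  have hMr : VertexFamily Mt N CM r := BalabanStepW2.vertexFamily_mono' hMloc hCM ((min_le_right _ _).trans (min_le_right _ _))
  have hV := SecondOrderResponse.vertexFamily_dM (N := N) hK hCK hSr hMr hr0 (min_le_left _ _) ν y'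
  funext x z a b
  show dper M (fun x z a b => -(comp (comp K (dM K N S Mt ν y')) K x z a b)) x z a b = _
  unfold K2OfK
  rw [show (fun x z a b => -(comp (comp K (dM K N S Mt ν y')) K x z a b)) = -(comp (comp K (dM K N S Mt ν y')) K) from rfl,
    show dper M (-(comp (comp K (dM K N S Mt ν y')) K)) = -(dper M (comp (comp K (dM K N S Mt ν y')) K)) by
      funext x' z' a' b'; simp only [dper_apply, Pi.neg_apply, tsum_neg],
    CombHId1Sandwich.dper_sandwich M hKinv hK hδK hV (half_pos hr0), dper_dM M K S Mt hM hKinv hK hCK hδK hSt hS hδS hMt hMloc hδM ν y']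
  rfl

end DM

end Summit.QuantumFields.BalabanUV.Beta.CombHId2Letters

end
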